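/-
Literature file (hubbard-downfold iridate row): the spin–orbit `J_eff = 1/2` doublet of a `t₂g` shell and the exact
projection of an orbital-diagonal hopping onto it ("twisted Hubbard model" of Sr₂IrO₄).
-/
import Mathlib
import HarnessLib

/-!
# The `t₂g` spin–orbit doublet `J_eff = 1/2` and the one-band projection of the hopping

In a `t₂g⁵` ion with strong spin–orbit coupling (Ir⁴⁺ in Sr₂IrO₄) the six `t₂g` spin-orbitals split under
`λ L·S` into a lower `J_eff = 3/2` quartet and an upper `J_eff = 1/2` Kramers doublet; five electrons fill
the quartet and half-fill the doublet, and the low-energy model is a one-band Hubbard model on the doublet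
(B. J. Kim et al. 2008; Wang–Senthil 2011). The hoppings of that one-band model are NOT the `t₂g` hoppings a
scalar-relativistic band calculation produces: they are their PROJECTION onto the doublet, Wang–Senthil 2011,
Eq. (3): with orbital-diagonal nearest-neighbour `t₂g` hoppings `t₁` (`XY`), `t₄`, `t₅` (`XZ`, `YZ`) in the local
cubic axes and octahedral rotation angles `θ_j = ε_j θ`,
`t = (1/3)(t₁ + t₄ + t₅) cos θ`, `t̄ = (1/3)(t₁ − t₄ − t₅) sin θ` (pseudospin-dependent phase), `t′ = t₂/3`,
`t″ = t₃/3`.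

This file makes that projection an exact finite-dimensional identity. Everything is PROVED by explicit
`6 × 6` complex linear algebra; the modelling inputs are the two definitions `soT2g` (the operator `L·S` on the
`t₂g` shell, T–P equivalence `L_eff = −L`) and the Wang–Senthil doublet `jeffPlus/jeffMinus` (their Eq. (2)).

Basis (index `0 … 5`): `(XZ↑, XZ↓, YZ↑, YZ↓, XY↑, XY↓)`, orbitals in the LOCAL cubic axes, spin quantised
along the local `Z`.

## Contents

* `soT2g` — `L·S` restricted to `t₂g` (with `ħ = 1`, `S = σ/2`, and the `t₂g ≃ p` correspondence
  `YZ ↦ x, XZ ↦ y, XY ↦ z` carrying `L ↦ −L`): an explicit Hermitian matrix (`soT2g_isHermitian`) with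
  `(L·S + ½)(L·S − 1) = 0` (`soT2g_minpoly`) and `tr = 0` (`soT2g_trace`), hence spectrum `{1 (×2), −½ (×4)}`:
  the doublet lies ABOVE the quartet by `3λ/2` for `λ > 0` [Kim et al. 2008, Fig. 1].
* `jeffPlus`, `jeffMinus` — `√3 ×` the Wang–Senthil states `|J_z = ±½⟩` (Eq. (2)):
  `√3 |+½⟩ = i|XY↑⟩ − |XZ↓⟩ + i|YZ↓⟩`, `√3 |−½⟩ = −i|XY↓⟩ + |XZ↑⟩ + i|YZ↑⟩`; PROVED: they are eigenvectors of
  `L·S` with the top eigenvalue `1` (`soT2g_mulVec_jeffPlus/Minus`), orthogonal, of squared norm `3`.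
* `hopT2g a b c` — an orbital-diagonal, spin-independent inter-site hopping block
  `diag(a, a, b, b, c, c)` (`a = t_XZ`, `b = t_YZ`, `c = t_XY`), and the TWISTED doublet
  `jeffPlusTw u`, `jeffMinusTw u` in which the spin-`↑` components carry a site phase `u` and the spin-`↓`
  components `ū` (`u_j = e^{iθ_j/2}` implements the local spin rotation of Wang–Senthil p. 2).
* THE PROJECTION IDENTITY (`proj_plus_plus`, `proj_minus_minus`, `proj_plus_minus`, `proj_minus_plus`):
  `⟨+_j| T |+_k⟩ = (t_XZ + t_YZ) u_j ū_k + t_XY ū_j u_k`, `⟨−_j| T |−_k⟩ = (t_XZ + t_YZ) ū_j u_k + t_XY u_j ū_k`,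
  `⟨+_j| T |−_k⟩ = ⟨−_j| T |+_k⟩ = 0` (for the `√3`-normalised vectors; divide by `3` for unit vectors:
  `proj_plus_plus_unit`), and its trigonometric form (`twist_trig`): with `u_j ū_k = e^{−iφ}`,
  `(t_XZ + t_YZ) e^{−iφ} + t_XY e^{iφ} = (t_XY + t_XZ + t_YZ) cos φ + i (t_XY − t_XZ − t_YZ) sin φ` — i.e.
  Wang–Senthil's `t = (1/3)(t₁ + t₄ + t₅) cos θ` and `t̄ = (1/3)(t₁ − t₄ − t₅) sin θ` with `t₁ = t_XY`,
  `{t₄, t₅} = {t_XZ, t_YZ}`, and a pseudospin-conserving (no `+ ↔ −`) hopping.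

USE (hubbard-downfold ROUTER, Sr₂IrO₄ row): a scalar-relativistic Wannier fit yields `t₂g` hoppings; the one-band
`J_eff = ½` box coordinates are the projections above, valid under the two printed assumptions
(orbital-diagonal hopping in LOCAL cubic axes; strong-SOC doublet) — a DERIVED quantity with this exact referent.

## References

* F. Wang, T. Senthil, *Twisted Hubbard model for Sr₂IrO₄: magnetism and possible high temperature
  superconductivity*, Phys. Rev. Lett. 106 (2011) 136402, Eqs. (2)–(3). [WangSenthil2011]
* B. J. Kim et al., *Novel J_eff = 1/2 Mott state induced by relativistic spin–orbit coupling in Sr₂IrO₄*,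
  Phys. Rev. Lett. 101 (2008) 076402, Fig. 1 and text (the `J_eff` level scheme). [KimEtAl2008]
-/

noncomputable section

open Complex ComplexConjugate Matrix

namespace Literature.MathematicalPhysics.QuantumManyBody

namespace T2gJeffHalf

/-! ## The spin–orbit operator on the `t₂g` shell -/

/-- `L·S` on the six `t₂g` spin-orbitals, basis `(XZ↑, XZ↓, YZ↑, YZ↓, XY↑, XY↓)` (local cubic axes), `ħ = 1`,
`S = σ/2`, orbital angular momentum through the `t₂g ≃ p` correspondence `YZ ↦ x, XZ ↦ y, XY ↦ z` with
`L_eff = −L` (so `(L_k)_{ab} = +i ε_{kab}` on the `p`-labels). Its top eigenvalue `+1` carries the `J_eff = ½`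
doublet, the eigenvalue `−½` the `J_eff = 3/2` quartet.
[cite: KimEtAl2008, Fig. 1 and text (t₂g split by ζ_SO L·S into J_eff = 1/2 above J_eff = 3/2)] -/
def soT2g : Matrix (Fin 6) (Fin 6) ℂ :=
  !![0, 0, -I / 2, 0, 0, I / 2;
     0, 0, 0, I / 2, I / 2, 0;
     I / 2, 0, 0, 0, 0, -1 / 2;
     0, -I / 2, 0, 0, 1 / 2, 0;
     0, -I / 2, 0, 1 / 2, 0, 0;
     -I / 2, 0, -1 / 2, 0, 0, 0]

/-- `√3 · |J_z = +½⟩ = i|XY↑⟩ − |XZ↓⟩ + i|YZ↓⟩` (components on `(XZ↑, XZ↓, YZ↑, YZ↓, XY↑, XY↓)`).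
[cite: WangSenthil2011, Eq. (2)] -/
def jeffPlus : Fin 6 → ℂ := ![0, -1, 0, I, I, 0]

/-- `√3 · |J_z = −½⟩ = −i|XY↓⟩ + |XZ↑⟩ + i|YZ↑⟩`. [cite: WangSenthil2011, Eq. (2)] -/
def jeffMinus : Fin 6 → ℂ := ![1, 0, I, 0, 0, -I]

/-- `L·S` on `t₂g` is Hermitian. [cite: KimEtAl2008, Fig. 1 (the operator is the atomic spin–orbit term)] -/
theorem soT2g_isHermitian : soT2g.IsHermitian := by
  rw [Matrix.IsHermitian]
  ext i j
  fin_cases i <;> fin_cases j <;> simp [soT2g, Matrix.conjTranspose_apply, div_eq_mul_inv]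

/-- **Minimal polynomial:** `(L·S + ½)(L·S − 1) = 0` on the `t₂g` shell, so its spectrum is contained in
`{−½, 1}` (`j_eff = 3/2` and `j_eff = 1/2`). [cite: KimEtAl2008, Fig. 1 (J_eff = 3/2 quartet and J_eff = 1/2 doublet)] -/
theorem soT2g_minpoly :
    (soT2g + (1 / 2 : ℂ) • (1 : Matrix (Fin 6) (Fin 6) ℂ)) * (soT2g - 1) = 0 := by
  ext i j
  fin_cases i <;> fin_cases j <;>
    simp [soT2g, Matrix.mul_apply, Fin.sum_univ_succ, Matrix.one_apply] <;> ring_nf <;> simp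

/-- `tr (L·S) = 0`; with `soT2g_minpoly` this fixes the multiplicities: `1` twice, `−½` four times
(`2·1 + 4·(−½) = 0`). [cite: KimEtAl2008, Fig. 1 (doublet + quartet)] -/
theorem soT2g_trace : soT2g.trace = 0 := by
  simp [Matrix.trace, Fin.sum_univ_succ, soT2g]

/-- **`|J_z = +½⟩` is an eigenvector of `L·S` with the top eigenvalue `1`** (energy `+λ`).
[cite: WangSenthil2011, Eq. (2); KimEtAl2008, Fig. 1] -/
theorem soT2g_mulVec_jeffPlus : soT2g *ᵥ jeffPlus = jeffPlus := by
  ext i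
  fin_cases i <;> simp [soT2g, jeffPlus, Matrix.mulVec, dotProduct, Fin.sum_univ_succ] <;> ring_nf
  simp

/-- **`|J_z = −½⟩` is an eigenvector of `L·S` with the top eigenvalue `1`.**
[cite: WangSenthil2011, Eq. (2); KimEtAl2008, Fig. 1] -/
theorem soT2g_mulVec_jeffMinus : soT2g *ᵥ jeffMinus = jeffMinus := by
  ext i
  fin_cases i <;> simp [soT2g, jeffMinus, Matrix.mulVec, dotProduct, Fin.sum_univ_succ] <;> ring_nf
  simp

/-- The two doublet states are orthogonal. [cite: WangSenthil2011, Eq. (2)] -/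
theorem jeffPlus_orth_jeffMinus : star jeffPlus ⬝ᵥ jeffMinus = 0 := by
  simp [jeffPlus, jeffMinus, dotProduct, Fin.sum_univ_succ]

/-- `‖√3 |+½⟩‖² = 3`. [cite: WangSenthil2011, Eq. (2)] -/
theorem jeffPlus_normSq : star jeffPlus ⬝ᵥ jeffPlus = 3 := by
  simp [jeffPlus, dotProduct, Fin.sum_univ_succ]
  norm_num

/-- `‖√3 |−½⟩‖² = 3`. [cite: WangSenthil2011, Eq. (2)] -/
theorem jeffMinus_normSq : star jeffMinus ⬝ᵥ jeffMinus = 3 := by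
  simp [jeffMinus, dotProduct, Fin.sum_univ_succ]
  norm_num

/-! ## Orbital-diagonal hopping and its projection onto the doublet -/

/-- An inter-site one-body block that is diagonal in the `t₂g` orbital and independent of spin:
`diag(a, a, b, b, c, c)` with `a = t_XZ`, `b = t_YZ`, `c = t_XY` (nearest-neighbour Ir–Ir hopping in the local
cubic axes). [cite: WangSenthil2011, p. 2 ("effective hoppings between nearest-neighbor Ir are orbital diagonal … only in the local cubic axis basis")] -/
def hopT2g (a b c : ℂ) : Matrix (Fin 6) (Fin 6) ℂ :=
  Matrix.diagonal ![a, a, b, b, c, c]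

/-- The TWISTED doublet state `√3 |+½⟩_j` on a site whose local spin frame carries the phase `u` on spin `↑` and
`ū` on spin `↓` (`u = e^{iθ_j/2}`): `(0, −ū, 0, iū, iu, 0)`; `jeffPlusTw 1 = jeffPlus`.
[cite: WangSenthil2011, p. 2 (substitution rules with the factors e^{i ε_ν θ_j / 2})] -/
def jeffPlusTw (u : ℂ) : Fin 6 → ℂ := ![0, -conj u, 0, I * conj u, I * u, 0]

/-- The twisted `√3 |−½⟩_j`: `(u, 0, iu, 0, 0, −iū)`; `jeffMinusTw 1 = jeffMinus`.
[cite: WangSenthil2011, p. 2 (substitution rules)] -/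
def jeffMinusTw (u : ℂ) : Fin 6 → ℂ := ![u, 0, I * u, 0, 0, -(I * conj u)]

/-- Untwisted case. [cite: WangSenthil2011, Eq. (2)] -/
theorem jeffPlusTw_one : jeffPlusTw 1 = jeffPlus := by
  ext i; fin_cases i <;> simp [jeffPlusTw, jeffPlus]

/-- Untwisted case. [cite: WangSenthil2011, Eq. (2)] -/
theorem jeffMinusTw_one : jeffMinusTw 1 = jeffMinus := by
  ext i; fin_cases i <;> simp [jeffMinusTw, jeffMinus]

/-- **Projection, `+ +`:** `⟨√3·+_j| T |√3·+_k⟩ = (t_XZ + t_YZ) u_j ū_k + t_XY ū_j u_k`.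
[cite: WangSenthil2011, Eq. (3) (the hopping t + i ε t̄ of the projected one-band model)] -/
theorem proj_plus_plus (a b c uj uk : ℂ) :
    star (jeffPlusTw uj) ⬝ᵥ (hopT2g a b c *ᵥ jeffPlusTw uk) =
      (a + b) * (uj * conj uk) + c * (conj uj * uk) := by
  simp [jeffPlusTw, hopT2g, dotProduct, Matrix.mulVec, Matrix.diagonal, Fin.sum_univ_succ]
  ring_nf
  simp only [Complex.I_sq]
  ring

/-- **Projection, `− −`:** `⟨√3·−_j| T |√3·−_k⟩ = (t_XZ + t_YZ) ū_j u_k + t_XY u_j ū_k`.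
[cite: WangSenthil2011, Eq. (3)] -/
theorem proj_minus_minus (a b c uj uk : ℂ) :
    star (jeffMinusTw uj) ⬝ᵥ (hopT2g a b c *ᵥ jeffMinusTw uk) =
      (a + b) * (conj uj * uk) + c * (uj * conj uk) := by
  simp [jeffMinusTw, hopT2g, dotProduct, Matrix.mulVec, Matrix.diagonal, Fin.sum_univ_succ]
  ring_nf
  simp only [Complex.I_sq]
  ring

/-- **Projection, `+ −`: no pseudospin flip.** [cite: WangSenthil2011, Eq. (3) (hopping diagonal in the pseudospin α)] -/
theorem proj_plus_minus (a b c uj uk : ℂ) :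
    star (jeffPlusTw uj) ⬝ᵥ (hopT2g a b c *ᵥ jeffMinusTw uk) = 0 := by
  simp [jeffPlusTw, jeffMinusTw, hopT2g, dotProduct, Matrix.mulVec, Matrix.diagonal, Fin.sum_univ_succ]

/-- **Projection, `− +`: no pseudospin flip.** [cite: WangSenthil2011, Eq. (3)] -/
theorem proj_minus_plus (a b c uj uk : ℂ) :
    star (jeffMinusTw uj) ⬝ᵥ (hopT2g a b c *ᵥ jeffPlusTw uk) = 0 := by
  simp [jeffPlusTw, jeffMinusTw, hopT2g, dotProduct, Matrix.mulVec, Matrix.diagonal, Fin.sum_univ_succ]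

/-- The untwisted, unit-normalised statement: for the unit vectors `|±½⟩ = (1/√3)·(√3|±½⟩)` and real hoppings,
`⟨+| T |+⟩ = (t_XZ + t_YZ + t_XY)/3` — Wang–Senthil's `t = (1/3)(t₁ + t₄ + t₅)` at `θ = 0`.
[cite: WangSenthil2011, Eq. (3) (θ = 0)] -/
theorem proj_plus_plus_unit (a b c : ℝ) :
    star (((Real.sqrt 3)⁻¹ : ℂ) • jeffPlus) ⬝ᵥ
        (hopT2g a b c *ᵥ (((Real.sqrt 3)⁻¹ : ℂ) • jeffPlus)) = ((a + b + c) / 3 : ℝ) := by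
  have h3 : Real.sqrt 3 * Real.sqrt 3 = 3 := Real.mul_self_sqrt (by norm_num)
  have hs : Real.sqrt 3 ≠ 0 := by positivity
  rw [← jeffPlusTw_one, Matrix.mulVec_smul, dotProduct_smul, star_smul, smul_dotProduct, proj_plus_plus]
  simp only [map_one, mul_one, smul_eq_mul]
  have hr : (starRingEnd ℂ) ((Real.sqrt 3 : ℂ)⁻¹) = ((Real.sqrt 3 : ℂ))⁻¹ := by
    rw [map_inv₀, Complex.conj_ofReal]
  rw [Complex.star_def, hr]
  have h3c : (Real.sqrt 3 : ℂ) * (Real.sqrt 3 : ℂ) = 3 := by exact_mod_cast h3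
  have key : ((Real.sqrt 3 : ℂ))⁻¹ * ((Real.sqrt 3 : ℂ))⁻¹ = 1 / 3 := by
    rw [← mul_inv, h3c, one_div]
  calc ((Real.sqrt 3 : ℂ))⁻¹ * (((Real.sqrt 3 : ℂ))⁻¹ * ((a : ℂ) + b + c))
      = (((Real.sqrt 3 : ℂ))⁻¹ * ((Real.sqrt 3 : ℂ))⁻¹) * ((a : ℂ) + b + c) := by ring
    _ = ((a + b + c) / 3 : ℝ) := by rw [key]; push_cast; ring

/-- **Trigonometric form of the twist** (`u_j ū_k = e^{−iφ}`): `(t_XZ + t_YZ) e^{−iφ} + t_XY e^{iφ}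
= (t_XY + t_XZ + t_YZ) cos φ + i (t_XY − t_XZ − t_YZ) sin φ` — the `t cos θ + i t̄ sin θ` structure of the
twisted Hubbard model (`t ∝ t₁ + t₄ + t₅`, `t̄ ∝ t₁ − t₄ − t₅`). [cite: WangSenthil2011, Eq. (3)] -/
theorem twist_trig (a b c φ : ℂ) :
    (a + b) * Complex.exp (-(φ * I)) + c * Complex.exp (φ * I) =
      (c + a + b) * Complex.cos φ + (c - a - b) * Complex.sin φ * I := by
  rw [show -(φ * I) = (-φ) * I by ring, Complex.exp_mul_I, Complex.exp_mul_I, Complex.cos_neg,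
    Complex.sin_neg]
  ring

/-- The phases `u = e^{iα}` compose as assumed in `twist_trig`: `u_j ū_k = e^{i(α_j − α_k)}`.
[cite: WangSenthil2011, p. 2 (site phases e^{i ε_ν θ_j/2})] -/
theorem phase_mul_conj (α β : ℝ) :
    Complex.exp (α * I) * conj (Complex.exp (β * I)) = Complex.exp ((α - β : ℝ) * I) := by
  rw [← Complex.exp_conj, map_mul, Complex.conj_ofReal, Complex.conj_I, ← Complex.exp_add]
  congr 1
  push_cast
  ring

end T2gJeffHalf

end Literature.MathematicalPhysics.QuantumManyBody

end
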